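/-
Copyright (c) 2026. All rights reserved.
Released under Apache 2.0 license as described in the file LICENSE.
Authors: abc-iut cell, statement-typer seat abc-iut-L4-t14 (wave 2).
-/
import Mathlib.Analysis.Complex.Circle
import Mathlib.Analysis.SpecialFunctions.Log.Basic
import Mathlib.Topology.Instances.RealVectorSpace
import Mathlib.Topology.Algebra.ContinuousMonoidHom
import Mathlib.Topology.MetricSpace.ProperSpace
import Mathlib.Algebra.Ring.Subring.Units
import HarnessLib

/-!
# [AbsTopIII] §2 "Archimedean Reconstruction Algorithms": Remarks 2.1.2, 2.3.1, 2.3.2, 2.4.1, 2.4.2, 2.6.1, 2.7.1–2.7.4, 2.8.2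

S. Mochizuki, *Topics in absolute anabelian geometry III: global reconstruction algorithms*,
J. Math. Sci. Univ. Tokyo 22 (2015) 939–1156 [MochizukiAbsTopIII2015]; locators `p.N` are the pages
of the author's kurims manuscript (lit key `paper:url-5493eb38cbb7`, 164 pp; the journal pagination is
not held), each read on the page.  This is the wave-2 block W2-B5 of the cell's L4 plan: the twelve
Remarks of §2 (pp. 50–65) that are not part of the §2 statement files of seat abc-iut-L4-t2
(`AutHolomorphicSpaces`: Def 2.1 (i)(ii), Prop 2.2, Cor 2.3, Rmk 2.3.3; `Coorientations`: Def 2.1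
(iii)(iv), Rmk 2.1.1; `HolomorphicCores`: Cor 2.4, Prop 2.5/2.6, Rmk 2.5.1; `ArchimedeanReconstruction`:
Cor 2.7–2.9, Rmk 2.8.1, 2.8.3).  Statements-first (D-0014): every mathematical assertion a Remark
makes is a named `Prop` with its locator, PROVED here when it is elementary (`…_holds`); the purely
expository Remarks (analogies, methodology) carry no assertion and are RECORDED in the index below by
locator and thesis sentence only — no structure is invented for them.

## Index of the twelve Remarks (node ids `AbsTopIII:Rmk…` of the cell census)

* **Rmk 2.1.2** p. 52 — RECORDED (expository): "One important aspect of the 'Aut-holomorphic'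
  approach to the notion of a 'holomorphic structure' is that this approach has the virtue of being
  free of any mention of some 'fixed reference model' copy of the field of complex numbers `ℂ`"
  [cf. Rmk 2.7.4].  Kernel-visible form: the carrier `AutHolStructure X` of seat L4-t2's
  `AutHolomorphicSpaces.lean` is data on a bare topological space (no `ℂ` in its type).
* **Rmk 2.3.1** p. 54 — RECORDED (expository): Cor 2.3 "may be thought of as one sort of complex
  analytic analogue of the Grothendieck Conjecture" with "the same essential mathematical content as
  [Mzk14], Theorem 1.12" (proofs via Cartan's theorem, real and `p`-adic).
* **Rmk 2.3.2** p. 54 — CLAIM, typed in the sibling file `RemarksArchimedeanLocal.lean` over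
  L4-t2's `IsLocalMorphism` / `IsLocalStructure` (it needs that module built): "the notion of a
  co-holomorphicization `𝕏 → 𝕐` is, in fact, independent of the choice of the local structures
  `𝒰`, `𝒱`" (from Cor 2.3 (ii)).
* **Rmk 2.4.1** p. 55 — RECORDED (extension claim, "one verifies immediately"): Cor 2.4 (holomorphic
  arithmeticity and cores, a functorial algorithm on Aut-holomorphic spaces) "admits a natural
  extension to the case where `X` arises from a hyperbolic orbicurve over `ℂ`" [cf. Rmk 2.1.1,
  Aut-holomorphic orbispaces = L4-t2's `AutHolOrbispace`].  Not typed separately: the orbispace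
  version is the same statement with `AutHolOrbispace` inputs; no IUT citation of this Remark.
* **Rmk 2.4.2** p. 55 — RECORDED (expository): Cor 2.4 "may be regarded as a sort of holomorphic
  analogue of results such as [Mzk10], Theorem 2.4, concerning categories of finite étale
  localizations of hyperbolic orbicurves" [cf. Rmk 2.7.3].
* **Rmk 2.6.1** p. 58 — RECORDED: "the algorithms of Propositions 2.5, 2.6 may be regarded as
  superseding the techniques applied in the proof of [Mzk14], Proposition A.4"; one "may apply" them
  "to give algorithms for reconstructing the local linear and orthogonal structures on a Riemann
  surface equipped with a nonzero square differential from the various categories which are the topic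
  of [Mzk14], Theorem 2.3.  We leave the routine details to the interested reader."  Not typed: the
  categories of [Mzk14] Thm 2.3 are not in the tree and the Remark is not cited by [IUTchI–IV].
* **Rmk 2.7.1** p. 60 — RECORDED (methodological): elliptic cuspidalization [Cor 2.7 (b), (c)] is not
  claimed to be "the unique way to construct this local additive structure"; "perhaps the most direct
  approach … is to compactify the given once-punctured elliptic curve and then to consider the group
  structure of the [connected component of the identity of the] holomorphic automorphism group of the
  resulting elliptic curve"; elliptic cuspidalization "has the virtue of being compatible with the
  'hyperbolic structure' of the hyperbolic orbicurves involved", may be thought of as "a sort of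
  discretization via torsion points" of the direct approach [Hodge–Arakelov point of view, [Mzk6],
  [Mzk7]], and "the density of torsion points in the archimedean theory … is reminiscent of the density
  of NF-points in the nonarchimedean theory of the Belyi cuspidalization [cf. §1]".
* **Rmk 2.7.2** pp. 60–61 — the comparison with [Mzk18] = [EtTh]: uniformization `G ↠ G/q^ℤ ≅ E`
  of an elliptic curve over `ℂ` by a copy `G` of `ℂ^×`, `q ∈ H := G ⊗ Gal(G/E)`, `Θ : G → H`;
  (a) "Cyclotomic rigidity corresponds to the portion of the tautological isomorphism
  `H ≅ G ⊗ Gal(G/E)` involving the maximal compact subgroups, i.e., the copies of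
  `S¹ := {z ∈ ℂ^× | |z| = 1} ⊆ ℂ^×`" — TYPED KERNEL, PROVED: `S¹` is *the* maximal compact subgroup
  of `ℂ^×` (`Rmk_2_7_2.Item_a`, `Rmk_2_7_2.Item_a_holds`); (b) "Discrete rigidity corresponds to the
  portion … involving the quotients by the maximal compact subgroups, i.e., the copies of
  `ℝ_{>0} := {z ∈ ℝ | z > 0} ≅ ℂ^×/S¹`" — TYPED KERNEL, PROVED: `ℂ^×/S¹ ≅ ℝ_{>0}` via `|·|`
  (`Rmk_2_7_2.Item_b`, `Rmk_2_7_2.Item_b_holds`); (c) "Constant rigidity corresponds to considering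
  the normalization of `Θ` given by taking the values of `Θ` at the points of `G` corresponding to
  `±√-1` to be `±1`" — RECORDED (the normalisation itself is [EtTh] Thm 1.10, layer L2).  The closing
  paragraph ("`A_p (≅ ℂ^×)` is related to `H (≅ ℂ^×)` by the operation of 'taking the logarithm',
  followed by the operation of 'taking Aut(−)'") is expository.
* **Rmk 2.7.3** pp. 61–62, items (i) "outer action of `G_k` on `Δ_X`" / (ii) "Aut-holomorphic
  orbispace" — the analogy itself is RECORDED ("one may think of Theorem 1.9 and Corollaries 1.10,
  2.7 as furnishing solutions to various versions of [the] problem of finding an algorithm to construct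
  the base field of a hyperbolic orbicurve from (i), (ii)"); its mathematical content is TYPED: "the
  topological group `ℂ^×` is also a two-dimensional object with one rigid dimension — i.e.
  `S¹ ⊆ ℂ^×` [a topological group whose automorphism group is of order `2`] — and one non-rigid
  dimension — i.e. `ℝ_{>0} ⊆ ℂ^×` [a topological group that is isomorphic to `ℝ`, hence has
  automorphism group given by `ℝ^×` — i.e., a 'continuous family of dilations']":
  `Rmk_2_7_3.posRealEquivReal` (`ℝ_{>0} ≅ ℝ` as topological groups, REAL), `Rmk_2_7_3.RealAutIsDilation`
  (PROVED: the continuous automorphisms of `(ℝ, +)` are exactly the dilations by `ℝ^×`),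
  `Rmk_2_7_3.CircleAutOrderTwo` (named FACT: every continuous automorphism of `S¹` is `z ↦ z` or
  `z ↦ z⁻¹`; the two are exhibited and distinguished here, `Rmk_2_7_3.circleInv_ne_refl`).
* **Rmk 2.7.4** p. 62 — RECORDED (methodological; thesis displayed on the page): "The notions of an
  'outer action of `G_k` on `Δ_X`' and an 'Aut-holomorphic orbispace' [cf. Remark 2.7.3, (i), (ii)]
  have the virtue of being 'model-implicit' — i.e., they do not depend on any sort of [local]
  comparison to some fixed reference model"; the dichotomy model-explicit/model-implicit "is strongly
  reminiscent of the distinction between bi-anabelian and mono-anabelian geometry discussed in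
  Remark 1.9.8".
* **Rmk 2.8.2** p. 64 — RECORDED (extension claim, "one verifies immediately"): Cor 2.8 "[as well as
  Corollary 2.9 below] may be extended to the case where `X` is a hyperbolic orbicurve that is not
  necessarily a curve [so `𝕏_v` will be an Aut-holomorphic orbispace]" — the orbi-version of L4-t2's
  `ArchimedeanReconstruction` statements; not typed separately.

Design: `ℂ^×` is Mathlib's `ℂˣ` with its units topology (`Units.isEmbedding_val₀`); `S¹` is the
kernel `Rmk_2_7_2.circle` of `|·| : ℂˣ →* ℝˣ`; `ℝ_{>0}` is `Units.posSubgroup ℝ`.  Refereed pre-IUT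
anabelian geometry; nothing in this file bears on the disputed [IUTchIII] Cor. 3.12, and the RECORDED
items assert nothing.  typed ≠ discharged except where a `…_holds` theorem is given.
-/

set_option autoImplicit false

noncomputable section

open Metric

namespace Literature.AnabelianGeometry.AbsoluteAnabelian.AbsTopIII

/-! ## Rmk 2.7.2 (a), (b): the maximal compact subgroup `S¹ ⊆ ℂ^×` and the quotient `ℂ^×/S¹ ≅ ℝ_{>0}` -/

namespace Rmk_2_7_2

/-- The absolute value `ℂ^× → ℝ^×`, `z ↦ |z|`, as a homomorphism of the unit groups.
[cite: MochizukiAbsTopIII2015, Rmk 2.7.2 (b) p.61] -/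
def absUnits : ℂˣ →* ℝˣ := Units.map ((normHom : ℂ →*₀ ℝ) : ℂ →* ℝ)

/-- `absUnits z = |z|`. [cite: MochizukiAbsTopIII2015, Rmk 2.7.2 (b) p.61] -/
@[simp] theorem val_absUnits (u : ℂˣ) : (absUnits u : ℝ) = ‖(u : ℂ)‖ := rfl

/-- `S¹ := {z ∈ ℂ^× | |z| = 1} ⊆ ℂ^×` ("the copies of `S¹`"), as the kernel of `|·|`.
[cite: MochizukiAbsTopIII2015, Rmk 2.7.2 (a) p.61] -/
def circle : Subgroup ℂˣ := absUnits.ker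

/-- membership in `S¹`: `|z| = 1`. [cite: MochizukiAbsTopIII2015, Rmk 2.7.2 (a) p.61] -/
theorem mem_circle_iff (u : ℂˣ) : u ∈ circle ↔ ‖(u : ℂ)‖ = 1 := by
  rw [circle, MonoidHom.mem_ker, ← Units.val_inj, val_absUnits, Units.val_one]

/-- under `ℂ^× ⊆ ℂ`, `S¹` is the unit sphere. [cite: MochizukiAbsTopIII2015, Rmk 2.7.2 (a) p.61] -/
theorem val_image_circle : (Units.val : ℂˣ → ℂ) '' (circle : Set ℂˣ) = sphere (0 : ℂ) 1 := by
  ext z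
  simp only [Set.mem_image, SetLike.mem_coe, mem_circle_iff, mem_sphere, dist_zero_right]
  constructor
  · rintro ⟨u, hu, rfl⟩
    exact hu
  · intro hz
    have hz0 : z ≠ 0 := by
      rintro rfl
      simp at hz
    exact ⟨Units.mk0 z hz0, hz, rfl⟩

/-- `S¹` is a compact subgroup of `ℂ^×`. [cite: MochizukiAbsTopIII2015, Rmk 2.7.2 (a) p.61] -/
theorem isCompact_circle : IsCompact (circle : Set ℂˣ) := by
  rw [Units.isEmbedding_val₀.isCompact_iff, val_image_circle]
  exact isCompact_sphere 0 1

/-- Every compact subgroup of `ℂ^×` is contained in `S¹`: a compact subgroup has bounded absolute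
values, and `|z| ≠ 1` would make `|z^{±n}|` unbounded. [cite: MochizukiAbsTopIII2015, Rmk 2.7.2 (a) p.61] -/
theorem le_circle_of_isCompact (K : Subgroup ℂˣ) (hK : IsCompact (K : Set ℂˣ)) : K ≤ circle := by
  have hcont : Continuous fun u : ℂˣ => ‖(u : ℂ)‖ := continuous_norm.comp Units.continuous_val
  obtain ⟨M, hM⟩ := (hK.image hcont).bddAbove
  have bound : ∀ u ∈ K, ‖(u : ℂ)‖ ≤ M := fun u hu => hM ⟨u, hu, rfl⟩
  have le_one : ∀ u ∈ K, ‖(u : ℂ)‖ ≤ 1 := by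
    intro u hu
    by_contra h
    rw [not_le] at h
    obtain ⟨n, hn⟩ := pow_unbounded_of_one_lt M h
    have hb := bound (u ^ n) (K.pow_mem hu n)
    rw [Units.val_pow_eq_pow_val, norm_pow] at hb
    exact absurd (hn.trans_le hb) (lt_irrefl _)
  intro u hu
  rw [mem_circle_iff]
  refine le_antisymm (le_one u hu) ?_
  have h := le_one u⁻¹ (K.inv_mem hu)
  rw [Units.val_inv_eq_inv_val, norm_inv] at h
  exact (inv_le_one₀ (norm_pos_iff.mpr u.ne_zero)).mp h

/-- **Rmk 2.7.2 (a)**, typed kernel: "the maximal compact subgroups, i.e., the copies of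
`S¹ := {z ∈ ℂ^× | |z| = 1} ⊆ ℂ^×`" — `S¹` is a compact subgroup of the topological group `ℂ^×`
containing every compact subgroup (so it is the unique maximal one).  [The sentence's identification
of this portion of `H ≅ G ⊗ Gal(G/E)` with the *cyclotomic rigidity* of [EtTh] is an analogy and is
recorded, not typed.] [cite: MochizukiAbsTopIII2015, Rmk 2.7.2 (a) p.61] -/
def Item_a : Prop :=
  IsCompact (circle : Set ℂˣ) ∧ ∀ K : Subgroup ℂˣ, IsCompact (K : Set ℂˣ) → K ≤ circle

/-- DISCHARGE of `Item_a`. [cite: MochizukiAbsTopIII2015, Rmk 2.7.2 (a) p.61] -/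
theorem Item_a_holds : Item_a := ⟨isCompact_circle, le_circle_of_isCompact⟩

/-- the image of `|·| : ℂ^× → ℝ^×` is `ℝ_{>0}`. [cite: MochizukiAbsTopIII2015, Rmk 2.7.2 (b) p.61] -/
theorem range_absUnits : absUnits.range = Units.posSubgroup ℝ := by
  ext r
  simp only [MonoidHom.mem_range, Units.mem_posSubgroup]
  constructor
  · rintro ⟨u, rfl⟩
    rw [val_absUnits]
    exact norm_pos_iff.mpr u.ne_zero
  · intro hr
    refine ⟨Units.mk0 ((r : ℝ) : ℂ) (Complex.ofReal_ne_zero.mpr hr.ne'), ?_⟩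
    ext
    rw [val_absUnits, Units.val_mk0, Complex.norm_real, Real.norm_eq_abs, abs_of_pos hr]

/-- **Rmk 2.7.2 (b)**, the isomorphism `ℂ^×/S¹ ≅ ℝ_{>0}` induced by `|·|` (REAL definition).
[cite: MochizukiAbsTopIII2015, Rmk 2.7.2 (b) p.61] -/
def quotientCircleEquivPosReal : ℂˣ ⧸ circle ≃* Units.posSubgroup ℝ :=
  (QuotientGroup.quotientKerEquivRange absUnits).trans (MulEquiv.subgroupCongr range_absUnits)

/-- **Rmk 2.7.2 (b)**, typed kernel: "the quotients by the maximal compact subgroups, i.e., the copies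
of `ℝ_{>0} := {z ∈ ℝ | z > 0} ≅ ℂ^×/S¹`".  [The identification with *discrete rigidity* is recorded,
not typed.] [cite: MochizukiAbsTopIII2015, Rmk 2.7.2 (b) p.61] -/
def Item_b : Prop := Nonempty (ℂˣ ⧸ circle ≃* Units.posSubgroup ℝ)

/-- DISCHARGE of `Item_b`. [cite: MochizukiAbsTopIII2015, Rmk 2.7.2 (b) p.61] -/
theorem Item_b_holds : Item_b := ⟨quotientCircleEquivPosReal⟩

end Rmk_2_7_2

/-! ## Rmk 2.7.3: `ℂ^×` has one rigid dimension `S¹` and one non-rigid dimension `ℝ_{>0} ≅ ℝ` -/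

namespace Rmk_2_7_3

/-- **Rmk 2.7.3**, the non-rigid dimension: "`ℝ_{>0} := {z ∈ ℝ | z > 0} ⊆ ℂ^×` [a topological group
that is isomorphic to `ℝ` …]" — the isomorphism of topological groups `log : ℝ_{>0} ≅ (ℝ, +)` with
inverse `exp` (REAL definition; `ℝ_{>0}` = `Units.posSubgroup ℝ`, `(ℝ, +)` written multiplicatively).
[cite: MochizukiAbsTopIII2015, Rmk 2.7.3 p.61] -/
def posRealEquivReal : Units.posSubgroup ℝ ≃ₜ* Multiplicative ℝ where
  toFun u := Multiplicative.ofAdd (Real.log ((u : ℝˣ) : ℝ))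
  invFun x := ⟨Units.mk0 (Real.exp x.toAdd) (Real.exp_pos _).ne', by
    rw [Units.mem_posSubgroup, Units.val_mk0]; exact Real.exp_pos _⟩
  left_inv u := by
    ext
    simp only [toAdd_ofAdd, Units.val_mk0]
    exact Real.exp_log u.2
  right_inv x := by
    simp only [Units.val_mk0, Real.log_exp, ofAdd_toAdd]
  map_mul' u v := by
    rw [← ofAdd_add, Subgroup.coe_mul, Units.val_mul, Real.log_mul u.2.ne' v.2.ne']
  continuous_toFun := by
    apply continuous_ofAdd.comp
    refine (Real.continuousOn_log.comp_continuous (Units.continuous_val.comp continuous_subtype_val) ?_)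
    intro u
    exact ne_of_gt u.2
  continuous_invFun := by
    apply Continuous.subtype_mk
    refine Units.continuous_iff.mpr ⟨?_, ?_⟩
    · exact Real.continuous_exp.comp continuous_toAdd
    · simp only [Units.val_inv_eq_inv_val, Units.val_mk0, ← Real.exp_neg]
      exact Real.continuous_exp.comp (continuous_neg.comp continuous_toAdd)

/-- the dilation `x ↦ a·x` by `a ∈ ℝ^×`, a continuous automorphism of `(ℝ, +)` ("a 'continuous family of
dilations'"). [cite: MochizukiAbsTopIII2015, Rmk 2.7.3 p.61] -/
def dilation (a : ℝˣ) : ℝ ≃ₜ+ ℝ where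
  toFun x := a * x
  invFun x := a⁻¹ * x
  left_inv x := by simp
  right_inv x := by simp
  map_add' x y := mul_add _ _ _
  continuous_toFun := continuous_const.mul continuous_id
  continuous_invFun := continuous_const.mul continuous_id

/-- `dilation a x = a·x`. [cite: MochizukiAbsTopIII2015, Rmk 2.7.3 p.61] -/
@[simp] theorem dilation_apply (a : ℝˣ) (x : ℝ) : dilation a x = a * x := rfl

/-- dilations compose multiplicatively: `a ↦ dilation a` is a homomorphism `ℝ^× → Aut(ℝ, +)`.
[cite: MochizukiAbsTopIII2015, Rmk 2.7.3 p.61] -/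
theorem dilation_mul (a b : ℝˣ) (x : ℝ) : dilation (a * b) x = dilation a (dilation b x) := by
  simp [mul_assoc]

/-- distinct units give distinct dilations. [cite: MochizukiAbsTopIII2015, Rmk 2.7.3 p.61] -/
theorem dilation_injective : Function.Injective dilation := by
  intro a b h
  have h1 := congrArg (fun f : ℝ ≃ₜ+ ℝ => f 1) h
  simp only [dilation_apply, mul_one] at h1
  exact Units.val_inj.mp h1

/-- **Rmk 2.7.3**, the non-rigid dimension: "[a topological group that is isomorphic to `ℝ`], hence has
automorphism group given by `ℝ^×` — i.e., a 'continuous family of dilations'" — typed: every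
continuous automorphism of the topological group `(ℝ, +)` is the dilation by a unique `a ∈ ℝ^×`.
[cite: MochizukiAbsTopIII2015, Rmk 2.7.3 p.61] -/
def RealAutIsDilation : Prop := ∀ f : ℝ ≃ₜ+ ℝ, ∃! a : ℝˣ, f = dilation a

/-- DISCHARGE of `RealAutIsDilation`: a continuous additive self-map of `ℝ` is `ℝ`-linear
(`AddMonoidHom.toRealLinearMap`), hence `x ↦ f(1)·x`, and `f(1) ≠ 0` by injectivity.
[cite: MochizukiAbsTopIII2015, Rmk 2.7.3 p.61] -/
theorem RealAutIsDilation_holds : RealAutIsDilation := by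
  intro f
  have hf1 : f 1 ≠ 0 := by
    intro h
    have : (1 : ℝ) = 0 := f.injective (by rw [h, map_zero])
    exact one_ne_zero this
  refine ⟨Units.mk0 (f 1) hf1, ?_, ?_⟩
  · ext x
    have hlin := (f.toAddMonoidHom.toRealLinearMap f.continuous_toFun).map_smul x (1 : ℝ)
    simp only [AddMonoidHom.coe_toRealLinearMap, smul_eq_mul, mul_one] at hlin
    rw [dilation_apply, Units.val_mk0, mul_comm]
    exact hlin
  · intro b hb
    apply Units.val_inj.mp
    have h1 := congrArg (fun g : ℝ ≃ₜ+ ℝ => g 1) hb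
    simp only [dilation_apply, mul_one] at h1
    rw [Units.val_mk0, h1]

/-- inversion `z ↦ z⁻¹` (complex conjugation on `S¹`), a continuous automorphism of the compact abelian
topological group `S¹` (Mathlib's `Circle`). [cite: MochizukiAbsTopIII2015, Rmk 2.7.3 p.61] -/
def circleInv : Circle ≃ₜ* Circle :=
  { MulEquiv.inv Circle with
    continuous_toFun := continuous_inv
    continuous_invFun := continuous_inv }

/-- `circleInv z = z⁻¹`. [cite: MochizukiAbsTopIII2015, Rmk 2.7.3 p.61] -/
@[simp] theorem circleInv_apply (z : Circle) : circleInv z = z⁻¹ := rfl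

/-- the two automorphisms `z ↦ z`, `z ↦ z⁻¹` of `S¹` are distinct (`i⁻¹ = -i ≠ i`), so the automorphism
group of `S¹` has order at least `2`. [cite: MochizukiAbsTopIII2015, Rmk 2.7.3 p.61] -/
theorem circleInv_ne_refl : circleInv ≠ ContinuousMulEquiv.refl Circle := by
  intro h
  let zI : Circle := ⟨Complex.I, by simp [Submonoid.unitSphere]⟩
  have h1 := congrArg (fun f : Circle ≃ₜ* Circle => ((f zI : Circle) : ℂ)) h
  simp only [circleInv_apply, ContinuousMulEquiv.refl_apply, Circle.coe_inv_eq_conj] at h1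
  have h2 : (starRingEnd ℂ) Complex.I = Complex.I := h1
  rw [Complex.conj_I] at h2
  have h3 := congrArg Complex.im h2
  norm_num at h3

/-- **Rmk 2.7.3**, the rigid dimension: "`S¹ := {z ∈ ℂ^× | |z| = 1} ⊆ ℂ^×` [a topological group whose
automorphism group is of order `2`]" — typed as the NAMED FACT that every continuous automorphism of
`S¹` is `z ↦ z` or `z ↦ z⁻¹` (classical: lift through `ℝ → S¹`; not proved here).  Together with
`circleInv_ne_refl` this says the automorphism group has order exactly `2`.
[cite: MochizukiAbsTopIII2015, Rmk 2.7.3 p.61] -/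
def CircleAutOrderTwo : Prop :=
  ∀ f : Circle ≃ₜ* Circle, f = ContinuousMulEquiv.refl Circle ∨ f = circleInv

end Rmk_2_7_3

end Literature.AnabelianGeometry.AbsoluteAnabelian.AbsTopIII

end
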